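import Mathlib
import HarnessLib
import Summits.HubbardSuperconductivity.HubbardSuperconductivity.Theorems.KLProgrammeKLRegimeSplitEdgeFactsPinnedFloorKlWindowC
import Summits.HubbardSuperconductivity.HubbardSuperconductivity.Theorems.KLProgrammeKLRegimeSplitEdgeFactsCumulativeFloorShape
import Summits.HubbardSuperconductivity.HubbardSuperconductivity.Theorems.KLProgrammeKLRegimeSplitEdgeFactsComplMemberJets
import Summits.HubbardSuperconductivity.HubbardSuperconductivity.Theorems.KLProgrammeKLRegimeSplitFrameDegreeGuard
import Summits.HubbardSuperconductivity.HubbardSuperconductivity.Theorems.KLProgrammeKLRegimeEngineV8DefsL4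

/-!
# Route `KLProgramme` — edge facts for the pair masses ACROSS TRANSFERS, XXIV: the (D3′) CUMULATIVE PINNED FLOOR BY VALUE for the complementary members —
# `b_lo·n − 4·b_lo ≤ Σ_{j<n} W₀(j)` on `klWindowC`, `b_lo = 3136/(27993600·π²·(4 + 2A))`, for ANY member assignment `j ↦ s_{j,m_j}` and ANY admissible frames `j ↦ K_j`

Cell gate-hubbard-kl, seat hubbard-kl-k3c1-p1 (g22; child-1 lineage).  E1 docket (3)/(5′)(s2), (D3′) half (S2-ROWS.md §2: `b_lo·n − s₀ ≤ Σ_{j<n} W₀(j)`, `U·s₀ < 1`, the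
hypothesis of row 17 `SWaveCascade.cascadeFamily_exists_pinnedAmplitude_of_cumulativeFloor`).  Composition of: row XXII's n-flat per-step floor on `klWindowC`
(`klwn_pinned_mass_floor_flat`), a CHOICE of the Matsubara index per scale (`k = ⌊(βΛ_j/(3π) + 1)/2⌋`, valid while `βΛ_j ≥ 6π`), the thermal bookkeeping
(`j + 2 ≤ n_β ⇒ βΛ_j ≥ 16π`, from `four_pow_nScales_le`), the pinned nonpositivity of the transfer weight (`klTransferWeight_pin_nonpos` with `klcd_soft_even`,
`klpf_soft_nonneg` ⇒ `0 ≤ W₀(j)` at EVERY scale) and row 33's shape `klcf_cumulative_floor` with the exceptional set `{0} ∪ {j < n : n_β < j + 2}` (at most 4 scales):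
* §1 `klcu_mass_nonneg`, `klcu_exists_index` (the choice of `k`), `klcu_thermal_ok` (`j + 2 ≤ n_β ⇒ 6π ≤ βΛ_j`), `klcu_card_exceptional_le`;
* §2 `klcu_per_step_floor` — XXII's flat floor with `k` chosen: at a scale `1 ≤ j`, `j + 2 ≤ n_β`, for `μ ∈ klWindowC`, `coeffNorm 0 K ≤ 1/20`, `10 ≤ L`, `β ≤ M` and the
  column threshold `2 ≤ (49/600)Λ_j L/(2π(4 + 2A))`: `b_lo ≤ −Σ_p t_j[s_{j,m}](0,p)`;
* §3 **`klcu_cumulative_floor`**: for `n ≤ n_β + 2`, frames `K_j` (`FrameOK R U (nScales β) μ K_j`, regime, `coeffNorm 0 K_j ≤ 1/20`), members `m_j ≥ j + 1`, `μ ∈ klWindowC`,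
  `10 ≤ L`, `β ≤ M`, and the column threshold at every `j < n`:  **`b_lo·n − b_lo·4 ≤ Σ_{j<n} (−Σ_p t_j^{K_j}[s^{K_j}_{j,m_j}](0,p))`** — the (D3′) shape BY VALUE with
  `s₀ = 4·b_lo` (`U·s₀ < 1` trivially), uniform in `β, L, M`, the frames and the member indices.
* §4 `klcu_column_threshold_of_klEngL₄` (`klEngL₄ ≤ L`, `0 < U ≤ 1`, `j ≤ n_β+1`, `v ≤ 8` ⇒ the column threshold), **`klcu_cumulative_floor_of_registered`** — the same floor
  with `10 ≤ L`, `β ≤ M` and the column threshold DISCHARGED from the registered binders `klEngL₄ P R β U ≤ L`, `klEngM₃ β U L ≤ M` (+ `0 < U ≤ 1`, `A ≤ 2`).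
With XXIII (`klsf_shortfall_le_numeric`, the (D2) shortfall by value) the E1 residual of (s2) for the complementary members is the NAMING (N) alone (plus plugging both into row 17).
Pure composition; no definitions; nothing asserts any slot, stub, K3 or SC.  References: the rows composed [folklore]; frame sizes [cite: BenfattoGiulianiMastropietro2006, §2.4 (2.36)].
-/

noncomputable section

namespace Summit.HubbardSuperconductivity.HubbardSuperconductivity.Theorems.KLRegimeSplit

set_option linter.dupNamespace false -- summit = problem name (single-conjunct summit), D-0017

open Real Finset Literature.MathematicalPhysics.QuantumLattice Literature.Probability.LatticeModels
open Summit.HubbardSuperconductivity.HubbardSuperconductivity.Theorems.KLProgrammeLegKernels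
open Summit.HubbardSuperconductivity.HubbardSuperconductivity.Theorems.DispersionFlow
open Summit.HubbardSuperconductivity.HubbardSuperconductivity.Theorems.PerturbedFermiCurve

/-! ## §1 Small facts -/

section Facts

variable {L M : ℕ} [NeZero L] (β μ : ℝ) (K : TrigPolyC4v)

/-- **The pinned mass of a complementary member is nonnegative at every scale**: `0 ≤ β`, `n ≤ m` ⟹ `0 ≤ −Σ_p t_n[s_{n,m}](0,p)` (`klTransferWeight_pin_nonpos` with the
member's evenness `klcd_soft_even` and nonnegativity `klpf_soft_nonneg`). [folklore] -/
theorem klcu_mass_nonneg [NeZero M] (hβ : 0 ≤ β) {n m : ℕ} (hnm : n ≤ m) :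
    0 ≤ -∑ p, klTransferWeight L M β μ K n (softSymbolCompl L M β μ K n m) 0 p := by
  rw [neg_nonneg]
  refine sum_nonpos fun p _ => ?_
  obtain ⟨h1, h2⟩ := klcd_soft_even β μ K (L := L) (M := M) n m
  exact klTransferWeight_pin_nonpos β μ K hβ n h1 h2 (fun k => klpf_soft_nonneg β μ K hnm k) p

omit [NeZero L] in
/-- **The choice of the Matsubara index**: `0 < β`, `Λ ≤ 1`, `6π ≤ βΛ`, `β ≤ M` ⟹ `k := ⌊(βΛ/(3π) + 1)/2⌋` satisfies `k ≤ M`, `(2k − 1)π/β ≤ Λ/3` and `βΛ/(6π) ≤ 2k`. [folklore] -/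
theorem klcu_exists_index {β Λ : ℝ} (hβ : 0 < β) (hΛ1 : Λ ≤ 1) (hΛ : 6 * π ≤ β * Λ) {M : ℕ} (hM : β ≤ M) :
    ∃ k : ℕ, k ≤ M ∧ (2 * (k : ℝ) - 1) * π / β ≤ Λ / 3 ∧ β * Λ / (6 * π) ≤ 2 * (k : ℝ) := by
  have hπ := Real.pi_pos
  have hπ3 : (3 : ℝ) < π := Real.pi_gt_three
  set x : ℝ := β * Λ / (3 * π) with hx
  have hx2 : 2 ≤ x := by rw [hx, le_div_iff₀ (by positivity)]; linarith
  set y : ℝ := (x + 1) / 2 with hy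
  have hy0 : 0 ≤ y := by rw [hy]; linarith
  refine ⟨⌊y⌋₊, ?_, ?_, ?_⟩
  · -- `k ≤ M`
    have hk : (⌊y⌋₊ : ℝ) ≤ y := Nat.floor_le hy0
    have hβ1 : 1 ≤ β := by nlinarith
    have hxβ : x ≤ β / (3 * π) := by
      rw [hx]; exact div_le_div_of_nonneg_right (by nlinarith) (by positivity)
    have hβ3 : β / (3 * π) ≤ β / 9 := by
      rw [div_le_div_iff₀ (by positivity) (by norm_num)]; nlinarith
    have hyM : y ≤ (M : ℝ) := by rw [hy]; linarith
    exact_mod_cast hk.trans hyM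
  · -- `(2k − 1)π/β ≤ Λ/3`
    have hk : (⌊y⌋₊ : ℝ) ≤ y := Nat.floor_le hy0
    have h1 : 2 * (⌊y⌋₊ : ℝ) - 1 ≤ x := by rw [hy] at hk; linarith
    have e : Λ / 3 = x * π / β := by rw [hx]; field_simp
    rw [e]
    rw [div_le_div_iff_of_pos_right hβ]
    exact mul_le_mul_of_nonneg_right h1 hπ.le
  · -- `βΛ/(6π) ≤ 2k`
    have hk : y < (⌊y⌋₊ : ℝ) + 1 := Nat.lt_floor_add_one y
    have e : β * Λ / (6 * π) = x / 2 := by rw [hx]; field_simp; ring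
    rw [e]
    rw [hy] at hk
    linarith

omit [NeZero L] in
/-- **Thermal bookkeeping**: `klBetaMin ≤ β`, `j + 2 ≤ n_β` ⟹ `6π ≤ β·Λ_j` (indeed `16π ≤ βΛ_j`: `4^{n_β} ≤ e₀β/π`, `Λ_j = e₀4^{−j} ≥ 16·e₀·4^{−n_β}`). [folklore] -/
theorem klcu_thermal_ok {β : ℝ} (hβ : klBetaMin ≤ β) {j : ℕ} (hj : j + 2 ≤ nScales β) : 6 * π ≤ β * klScale klE0 j := by
  have hβ0 : 0 < β := lt_of_lt_of_le (by norm_num [klBetaMin]) hβ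
  have hπ := Real.pi_pos
  have h4 := four_pow_nScales_le hβ
  have hΛ : klScale klE0 j = klE0 * ((4 : ℝ) ^ j)⁻¹ := rfl
  have hpow : (4 : ℝ) ^ j * 16 ≤ (4 : ℝ) ^ nScales β := by
    calc (4 : ℝ) ^ j * 16 = 4 ^ (j + 2) := by rw [pow_add]; norm_num
      _ ≤ 4 ^ nScales β := pow_le_pow_right₀ (by norm_num) hj
  have h4j : (0 : ℝ) < (4 : ℝ) ^ j := by positivity
  rw [hΛ]
  -- `β·e₀/4^j ≥ 16·β·e₀/4^{n_β} ≥ 16π`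
  have h1 : 16 * π * (4 : ℝ) ^ j ≤ klE0 * β := by
    have := mul_le_mul_of_nonneg_left hpow hπ.le
    have h4' : π * (4 : ℝ) ^ nScales β ≤ klE0 * β := by
      rw [le_div_iff₀ hπ] at h4; linarith
    nlinarith
  rw [show β * (klE0 * ((4 : ℝ) ^ j)⁻¹) = klE0 * β / (4 : ℝ) ^ j by field_simp, le_div_iff₀ h4j]
  nlinarith

omit [NeZero L] in
/-- The exceptional scales `{0} ∪ {j < n : n_β < j + 2}` number at most `4` when `n ≤ n_β + 2`. [folklore] -/
theorem klcu_card_exceptional_le {β : ℝ} {n : ℕ} (hn : n ≤ nScales β + 2) :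
    (insert 0 ((range n).filter fun j => ¬ j + 2 ≤ nScales β)).card ≤ 4 := by
  classical
  have hsub : ((range n).filter fun j => ¬ j + 2 ≤ nScales β) ⊆ Ico (nScales β - 1) (nScales β + 2) := fun j hj => by
    rw [mem_filter, mem_range] at hj; rw [mem_Ico]; omega
  have h3 : ((range n).filter fun j => ¬ j + 2 ≤ nScales β).card ≤ 3 :=
    (card_le_card hsub).trans (by rw [Nat.card_Ico]; omega)
  exact (card_insert_le _ _).trans (by omega)

end Facts

/-! ## §2 The per-step floor with the Matsubara index chosen -/

section Floor

variable {L M : ℕ} [NeZero L] (β μ : ℝ)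
variable {R : RenConsts} (hR : ∀ j, 0 ≤ R.Gfr j) {U c : ℝ} (hc : 0 ≤ c) (hβmin : klBetaMin ≤ β) (hβc : β ≤ Real.exp (c / U ^ 2))
include hR hc hβmin hβc

/-- **Per-step floor, index chosen**: for a frame `K` with `FrameOK R U (nScales β) μ K` in the regime and `coeffNorm 0 K ≤ 1/20`, at a scale `1 ≤ j`, `j + 2 ≤ n_β`,
member `j + 1 ≤ m`, on `μ ∈ klWindowC` with `10 ≤ L`, `β ≤ M` and the column threshold: `3136/(27993600π²(4 + 2A)) ≤ −Σ_p t_j[s_{j,m}](0,p)`. [folklore] -/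
theorem klcu_per_step_floor [NeZero M] {K : TrigPolyC4v} (hK : FrameOK R U (nScales β) μ K) (hκ₀ : K.coeffNorm 0 ≤ 1 / 20) (hμ : μ ∈ klWindowC)
    {j m : ℕ} (hj : 1 ≤ j) (hjβ : j + 2 ≤ nScales β) (hjm : j + 1 ≤ m) (hL : 10 ≤ L) (hM : β ≤ M)
    (hX2 : 2 ≤ 49 / 600 * klScale klE0 j * L / (2 * π * (4 + 2 * (2 * R.Gfr 0 * |U| + 2 * R.Gfr 1 * U ^ 2 + R.Gfr 2 * (c / Real.log 4))))) :
    3136 / (27993600 * π ^ 2 * (4 + 2 * (2 * R.Gfr 0 * |U| + 2 * R.Gfr 1 * U ^ 2 + R.Gfr 2 * (c / Real.log 4)))) ≤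
      -∑ p, klTransferWeight L M β μ K j (softSymbolCompl L M β μ K j m) 0 p := by
  have hβ0 : 0 < β := lt_of_lt_of_le (by norm_num [klBetaMin]) hβmin
  have hΛ1 : klScale klE0 j ≤ 1 := (klwn_klScale_le j hj).trans (by norm_num)
  obtain ⟨k, hk, hkW, hklo⟩ := klcu_exists_index hβ0 hΛ1 (klcu_thermal_ok hβmin hjβ) hM
  exact klwn_pinned_mass_floor_flat β μ hR hc hβmin hβc hK hβ0 hμ hκ₀ hj hjm hL hk hkW hklo hX2

/-! ## §3 The cumulative floor by value -/

/-- **THE (D3′) CUMULATIVE PINNED FLOOR BY VALUE** (module docstring): `b_lo·n − b_lo·4 ≤ Σ_{j<n} W₀(j)`, `b_lo = 3136/(27993600π²(4 + 2A))`, for `n ≤ n_β + 2`,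
any admissible frames `K_j` with small plain coefficient weight and any members `m_j ≥ j + 1`, on `klWindowC`. [folklore] -/
theorem klcu_cumulative_floor [NeZero M] {Kf : ℕ → TrigPolyC4v} (hKf : ∀ j, FrameOK R U (nScales β) μ (Kf j))
    (hκ₀ : ∀ j, (Kf j).coeffNorm 0 ≤ 1 / 20) {mf : ℕ → ℕ} (hmf : ∀ j, j + 1 ≤ mf j) (hμ : μ ∈ klWindowC) (hL : 10 ≤ L) (hM : β ≤ M)
    {n : ℕ} (hn : n ≤ nScales β + 2)
    (hX2 : ∀ j, j < n → 2 ≤ 49 / 600 * klScale klE0 j * L / (2 * π * (4 + 2 * (2 * R.Gfr 0 * |U| + 2 * R.Gfr 1 * U ^ 2 + R.Gfr 2 * (c / Real.log 4))))) :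
    3136 / (27993600 * π ^ 2 * (4 + 2 * (2 * R.Gfr 0 * |U| + 2 * R.Gfr 1 * U ^ 2 + R.Gfr 2 * (c / Real.log 4)))) * n -
        3136 / (27993600 * π ^ 2 * (4 + 2 * (2 * R.Gfr 0 * |U| + 2 * R.Gfr 1 * U ^ 2 + R.Gfr 2 * (c / Real.log 4)))) * (4 : ℕ) ≤
      ∑ j ∈ range n, -∑ p, klTransferWeight L M β μ (Kf j) j (softSymbolCompl L M β μ (Kf j) j (mf j)) 0 p := by
  classical
  have hβ0 : 0 < β := lt_of_lt_of_le (by norm_num [klBetaMin]) hβmin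
  have hv0 : 0 ≤ 4 + 2 * (2 * R.Gfr 0 * |U| + 2 * R.Gfr 1 * U ^ 2 + R.Gfr 2 * (c / Real.log 4)) := by
    have := klrg_size_nonneg hR hc (U := U); linarith
  have hb : 0 ≤ 3136 / (27993600 * π ^ 2 * (4 + 2 * (2 * R.Gfr 0 * |U| + 2 * R.Gfr 1 * U ^ 2 + R.Gfr 2 * (c / Real.log 4)))) := by positivity
  refine klcf_cumulative_floor (fun j => -∑ p, klTransferWeight L M β μ (Kf j) j (softSymbolCompl L M β μ (Kf j) j (mf j)) 0 p)
    (fun j => klcu_mass_nonneg β μ (Kf j) hβ0.le (by have := hmf j; omega)) hb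
    (insert 0 ((range n).filter fun j => ¬ j + 2 ≤ nScales β)) (klcu_card_exceptional_le hn) n fun j hjn hjE => ?_
  rw [mem_insert, mem_filter, mem_range, not_or, not_and, not_not] at hjE
  have hj1 : 1 ≤ j := by have := hjE.1; omega
  have hjβ : j + 2 ≤ nScales β := hjE.2 hjn
  exact klcu_per_step_floor β μ hR hc hβmin hβc (hKf j) (hκ₀ j) hμ hj1 hjβ (hmf j) hL hM (hX2 j hjn)

end Floor

/-! ## §4 The thresholds from the REGISTERED binders `klEngL₄ P R β U ≤ L`, `klEngM₃ β U L ≤ M` -/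

section Thresholds

open Summit.HubbardSuperconductivity.HubbardSuperconductivity.Theorems.EngineV8

variable {L M : ℕ} [NeZero L] (β μ : ℝ)
variable {R : RenConsts} (hR : ∀ j, 0 ≤ R.Gfr j) {U c : ℝ} (hc : 0 ≤ c) (hβmin : klBetaMin ≤ β) (hβc : β ≤ Real.exp (c / U ^ 2))

omit [NeZero L] in
/-- **The column threshold from the registered volume threshold**: `klEngL₄ P R β U ≤ L` (`≥ 2^61·β³/U`), `0 < U ≤ 1`, `klBetaMin ≤ β`, `j ≤ n_β + 1`
(`Λ_j ≥ π/(4β)`), `0 < v ≤ 8` ⟹ `2 ≤ (49/600)Λ_j·L/(2πv)` (room `≈ 2^50·β²`). [folklore] -/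
theorem klcu_column_threshold_of_klEngL₄ {P : SplitConsts} (hβ : klBetaMin ≤ β) (hU : 0 < U) (hU1 : U ≤ 1) (hL : klEngL₄ P R β U ≤ L)
    {j : ℕ} (hj : j ≤ nScales β + 1) {v : ℝ} (hv0 : 0 < v) (hv8 : v ≤ 8) : 2 ≤ 49 / 600 * klScale klE0 j * L / (2 * π * v) := by
  have hβ0 : 0 < β := lt_of_lt_of_le (by norm_num [klBetaMin]) hβ
  have h128 : (128 : ℝ) ≤ β := by simpa [klBetaMin] using hβ
  have hπ := Real.pi_pos
  have hπ4 : π < 4 := Real.pi_lt_four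
  -- volume: `2^61 β³ ≤ L`
  have hLr := klEngL4Real_le_of_klEngL₄_le hL
  have hP := one_le_klEngPsq P
  have hRq := one_le_klEngRsq R
  have hL3 : 2 ^ 61 * β ^ 3 ≤ (L : ℝ) := by
    refine le_trans ?_ hLr
    unfold klEngL4Real
    rw [le_div_iff₀ hU]
    have hP2 : 1 ≤ klEngPsq P ^ 2 := one_le_pow₀ hP
    have hR2 : 1 ≤ klEngRsq R ^ 2 := one_le_pow₀ hRq
    have hPR : 1 ≤ klEngPsq P ^ 2 * klEngRsq R ^ 2 := one_le_mul_of_one_le_of_one_le hP2 hR2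
    have hβ3 : 0 ≤ β ^ 3 := by positivity
    have h1 : 2 ^ 61 * β ^ 3 * U ≤ 2 ^ 61 * β ^ 3 * 1 := mul_le_mul_of_nonneg_left hU1 (by positivity)
    have h2 : 2 ^ 61 * β ^ 3 * 1 ≤ 2 ^ 61 * (klEngPsq P ^ 2 * klEngRsq R ^ 2) * β ^ 3 := by
      nlinarith [mul_le_mul_of_nonneg_left hPR (by positivity : (0 : ℝ) ≤ 2 ^ 61 * β ^ 3)]
    calc 2 ^ 61 * β ^ 3 * U ≤ 2 ^ 61 * (klEngPsq P ^ 2 * klEngRsq R ^ 2) * β ^ 3 := h1.trans h2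
      _ = 2 ^ 61 * klEngPsq P ^ 2 * klEngRsq R ^ 2 * β ^ 3 := by ring
  -- depth: `π/(4β) ≤ Λ_j`
  have h4 := four_pow_nScales_le hβ
  have hpow : (4 : ℝ) ^ j ≤ 4 * (4 : ℝ) ^ nScales β := by
    calc (4 : ℝ) ^ j ≤ 4 ^ (nScales β + 1) := pow_le_pow_right₀ (by norm_num) hj
      _ = 4 * 4 ^ nScales β := by rw [pow_succ]; ring
  have h4j : (0 : ℝ) < (4 : ℝ) ^ j := by positivity
  have hΛ : klScale klE0 j = klE0 * ((4 : ℝ) ^ j)⁻¹ := rfl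
  have hΛlo : π / (4 * β) ≤ klScale klE0 j := by
    rw [hΛ, div_le_iff₀ (by positivity)]
    have e : klE0 * ((4 : ℝ) ^ j)⁻¹ * (4 * β) = 4 * (klE0 * β) / (4 : ℝ) ^ j := by field_simp
    rw [e, le_div_iff₀ h4j]
    have h4' : π * (4 : ℝ) ^ nScales β ≤ klE0 * β := by rw [le_div_iff₀ hπ] at h4; linarith
    nlinarith
  -- assemble
  rw [le_div_iff₀ (by positivity)]
  have hprod : π / (4 * β) * (2 ^ 61 * β ^ 3) ≤ klScale klE0 j * L :=
    mul_le_mul hΛlo hL3 (by positivity) (klth_klScale_pos j).le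
  have e2 : π / (4 * β) * (2 ^ 61 * β ^ 3) = 2 ^ 59 * π * β ^ 2 := by
    field_simp
    ring
  rw [e2] at hprod
  have h1 : 2 * (2 * π * v) ≤ 32 * π := by nlinarith
  have hβ2 : (16384 : ℝ) ≤ β ^ 2 := by nlinarith
  have h2 : 32 * π ≤ 49 / 600 * (2 ^ 59 * π * β ^ 2) := by nlinarith
  have h3 : 49 / 600 * (2 ^ 59 * π * β ^ 2) ≤ 49 / 600 * (klScale klE0 j * (L : ℝ)) := mul_le_mul_of_nonneg_left hprod (by norm_num)
  have e3 : 49 / 600 * klScale klE0 j * (L : ℝ) = 49 / 600 * (klScale klE0 j * (L : ℝ)) := by ring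
  rw [e3]
  linarith

include hR hc hβmin hβc in
/-- **THE (D3′) CUMULATIVE FLOOR BY VALUE UNDER THE REGISTERED BINDERS**: as `klcu_cumulative_floor`, with the volume/Matsubara thresholds discharged from
`klEngL₄ P R β U ≤ L`, `klEngM₃ β U L ≤ M`, `0 < U ≤ 1` and `A ≤ 2` (so `v = 4 + 2A ≤ 8`), for `n ≤ n_β + 2`. [folklore] -/
theorem klcu_cumulative_floor_of_registered [NeZero M] {P : SplitConsts} (hU : 0 < U) (hU1 : U ≤ 1)
    (hA2 : 2 * R.Gfr 0 * |U| + 2 * R.Gfr 1 * U ^ 2 + R.Gfr 2 * (c / Real.log 4) ≤ 2)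
    (hL : klEngL₄ P R β U ≤ L) (hM : klEngM₃ β U L ≤ M)
    {Kf : ℕ → TrigPolyC4v} (hKf : ∀ j, FrameOK R U (nScales β) μ (Kf j)) (hκ₀ : ∀ j, (Kf j).coeffNorm 0 ≤ 1 / 20)
    {mf : ℕ → ℕ} (hmf : ∀ j, j + 1 ≤ mf j) (hμ : μ ∈ klWindowC) {n : ℕ} (hn : n ≤ nScales β + 2) :
    3136 / (27993600 * π ^ 2 * (4 + 2 * (2 * R.Gfr 0 * |U| + 2 * R.Gfr 1 * U ^ 2 + R.Gfr 2 * (c / Real.log 4)))) * n -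
        3136 / (27993600 * π ^ 2 * (4 + 2 * (2 * R.Gfr 0 * |U| + 2 * R.Gfr 1 * U ^ 2 + R.Gfr 2 * (c / Real.log 4)))) * (4 : ℕ) ≤
      ∑ j ∈ range n, -∑ p, klTransferWeight L M β μ (Kf j) j (softSymbolCompl L M β μ (Kf j) j (mf j)) 0 p := by
  have hA0 := klrg_size_nonneg hR hc (U := U)
  have hv0 : 0 < 4 + 2 * (2 * R.Gfr 0 * |U| + 2 * R.Gfr 1 * U ^ 2 + R.Gfr 2 * (c / Real.log 4)) := by linarith
  have hv8 : 4 + 2 * (2 * R.Gfr 0 * |U| + 2 * R.Gfr 1 * U ^ 2 + R.Gfr 2 * (c / Real.log 4)) ≤ 8 := by linarith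
  -- `10 ≤ L` from `2^10 ≤ klEngL₃ ≤ klEngL₄ ≤ L`
  have hL10 : 10 ≤ L := le_trans (by norm_num) ((two_pow_ten_le_klEngL₃ β U).trans (klEngL₃_le_of_klEngL₄_le hL))
  -- `β ≤ M` from `klEngM₃ β U L ≤ M`
  have hMβ : β ≤ M := by
    have h1 : β ≤ (⌈|β|⌉₊ : ℝ) := (le_abs_self β).trans (Nat.le_ceil _)
    have h2 : (⌈|β|⌉₊ : ℕ) ≤ klEngM₃ β U L := by
      unfold klEngM₃
      calc ⌈|β|⌉₊ ≤ (⌈|β|⌉₊ + 1) ^ 2 := by nlinarith [Nat.zero_le ⌈|β|⌉₊]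
        _ ≤ 2 ^ 10 * (⌈|β|⌉₊ + 1) ^ 2 := Nat.le_mul_of_pos_left _ (by norm_num)
        _ ≤ 2 ^ 10 * (⌈|β|⌉₊ + 1) ^ 2 * (L + 1) ^ 2 := Nat.le_mul_of_pos_right _ (by positivity)
    have h3 : ((⌈|β|⌉₊ : ℕ) : ℝ) ≤ (M : ℝ) := by exact_mod_cast h2.trans hM
    exact h1.trans h3
  refine klcu_cumulative_floor β μ hR hc hβmin hβc hKf hκ₀ hmf hμ hL10 hMβ hn fun j hjn => ?_
  exact klcu_column_threshold_of_klEngL₄ β hβmin hU hU1 hL (by omega) hv0 hv8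

end Thresholds

end Summit.HubbardSuperconductivity.HubbardSuperconductivity.Theorems.KLRegimeSplit

end
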